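import Summits.NavierStokesRegularity.NavierStokesRegularity.Theorems.RecurrentProfilesRecurrentLiouvilleClockKeepsClock
import Summits.NavierStokesRegularity.NavierStokesRegularity.Theorems.SqueezeCycleExtremalBiaxialitySubcriticalGaugeStrainBound
import HarnessLib

/-!
# Crux `RecurrentLiouville` (stmt-NavierStokesRegularity-1589), line `Sketch` (ideator 4, stretching
# clock) — stub `stub_clockEpochDensity`: strain-active epochs of a Type-I singularity model have
# positive logarithmic density (the card's K2′ on the class)

Theorems-only file.  **Main result** (`stub_clockEpochDensity`, registered): let `(u, p, G)` be an
origin-singular Albritton–Barker class profile with rate constant `C` and `v ∈ A_C` its Type-I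
ancient mild representative.  There are constants `K` (the clock constant of `stub_clockKeepsClock`)
and `K₁ ≥ 1` (a gauge bound of the strain form, `(−t)⟪∇v ξ, ξ⟫ ≤ K₁‖ξ‖²`, KNSS Prop. 4.1) such that
for every window `t₀ < t₁ < 0`, every `δ > 0` and every continuous `χ ≥ 0` which is `≥ 1` at the
`δ`-ACTIVE times of the window (times at which somewhere `(−t)⟪∇v ξ, ξ⟫ > (1 − δ)‖ξ‖²`),

`δ/(K₁ − 1 + δ) · log(t₀/t₁) − K/(K₁ − 1 + δ) ≤ ∫_{t₀}^{t₁} χ(t) dt/(−t)` :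

in Leray's log-time the strain-active epochs fill at least the fraction `δ/(K₁ − 1 + δ)` of every
long window — a Type-I singularity model cannot rest between bursts of near-critical stretching
(portrait clause; design constraint per period for `λ`-DSS candidates).  Proof: the abstract
epoch-density lemma `clock_epochDensity` fed with the clock law `stub_clockKeepsClock` and the gauge
bound `exists_gauge_norm_fderiv_le_of_typeI`.

## References

* P. Constantin, SIAM Review 36 (1994) 73–98; Comm. Math. Phys. 129 (1990) (2.9).
* G. Koch, N. Nadirashvili, G. Seregin, V. Šverák, Acta Math. 203 (2009), Prop. 4.1.
-/

noncomputable section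

-- the sub-problem namespace repeats the summit name (D-0017 layout `Summit.<S>.<P>.Theorems`)
set_option linter.dupNamespace false

namespace Summit.NavierStokesRegularity.NavierStokesRegularity.Theorems

open MeasureTheory Set Function Filter Topology TopologicalSpace Metric
open Literature.Analysis Literature.Analysis.FluidPDE
open scoped NNReal ENNReal RealInnerProductSpace

/-- **Gauge bound of the strain form** on `A_C`: `(−t)⟪∇v(t,x)ξ, ξ⟫ ≤ K₁‖ξ‖²` with `K₁ ≥ 1`
(Cauchy–Schwarz and the KNSS gauge gradient bound `(−t)‖∇v‖ ≤ K₀(C)`).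
[cite: KochNadirashviliSereginSverak2009, Prop. 4.1 (4.10) with k = 1] -/
theorem clockED_strain_gauge (C : ℝ) :
    ∃ K₁ : ℝ, 1 ≤ K₁ ∧ ∀ ⦃v : ℝ → EuclideanSpace ℝ (Fin 3) → EuclideanSpace ℝ (Fin 3)⦄,
      IsTypeIAncientMild C v → ∀ t : ℝ, t < 0 → ∀ (x ξ : EuclideanSpace ℝ (Fin 3)),
        (-t) * ⟪fderiv ℝ (v t) x ξ, ξ⟫ ≤ K₁ * ‖ξ‖ ^ 2 := by
  obtain ⟨K₀, hK₀⟩ := exists_gauge_norm_fderiv_le_of_typeI C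
  refine ⟨|K₀| + 1, by linarith [abs_nonneg K₀], fun v hv t ht x ξ => ?_⟩
  have h1 : ⟪fderiv ℝ (v t) x ξ, ξ⟫ ≤ ‖fderiv ℝ (v t) x‖ * ‖ξ‖ ^ 2 := by
    calc ⟪fderiv ℝ (v t) x ξ, ξ⟫ ≤ ‖fderiv ℝ (v t) x ξ‖ * ‖ξ‖ := real_inner_le_norm _ _
      _ ≤ ‖fderiv ℝ (v t) x‖ * ‖ξ‖ * ‖ξ‖ := by
          gcongr; exact ContinuousLinearMap.le_opNorm _ _
      _ = ‖fderiv ℝ (v t) x‖ * ‖ξ‖ ^ 2 := by ring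
  have h2 : (-t) * ‖fderiv ℝ (v t) x‖ ≤ K₀ := hK₀ hv t ht x
  have ht' : 0 < -t := neg_pos.2 ht
  calc (-t) * ⟪fderiv ℝ (v t) x ξ, ξ⟫ ≤ (-t) * (‖fderiv ℝ (v t) x‖ * ‖ξ‖ ^ 2) := by gcongr
    _ = ((-t) * ‖fderiv ℝ (v t) x‖) * ‖ξ‖ ^ 2 := by ring
    _ ≤ K₀ * ‖ξ‖ ^ 2 := by gcongr
    _ ≤ (|K₀| + 1) * ‖ξ‖ ^ 2 := by gcongr; linarith [le_abs_self K₀]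

/-- **Strain-active epochs of a Type-I singularity model have positive logarithmic density**
(registered stub `stub_clockEpochDensity` of line `Sketch`; the card's K2′ on the class; recurrence-free).
[cite: Constantin1990, (2.9)] -/
theorem stub_clockEpochDensity :
    ∀ (C : ℝ) (u : ℝ → EuclideanSpace ℝ (Fin 3) → EuclideanSpace ℝ (Fin 3))
      (p : ℝ → EuclideanSpace ℝ (Fin 3) → ℝ)
      (G : ℝ → EuclideanSpace ℝ (Fin 3) → EuclideanSpace ℝ (Fin 3) →L[ℝ] EuclideanSpace ℝ (Fin 3))
      (v : ℝ → EuclideanSpace ℝ (Fin 3) → EuclideanSpace ℝ (Fin 3)),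
      IsSuitableWeakSolutionOn (slab (EuclideanSpace ℝ (Fin 3)) (Iio 0) isOpen_Iio) 1 0 u p →
      HasWeakSpatialGradientOn (slab (EuclideanSpace ℝ (Fin 3)) (Iio 0) isOpen_Iio) u G →
      typeIBound (Iio (0 : ℝ) ×ˢ univ) u p G < ⊤ →
      HasTypeITimeDecay C u →
      IsBackwardSingularPoint u 0 →
      IsTypeIAncientMild C v →
      (∀ᵐ z ∂(volume.restrict (Iio (0 : ℝ) ×ˢ (univ : Set (EuclideanSpace ℝ (Fin 3))))),
        uncurry u z = uncurry v z) →
      ∃ K K₁ : ℝ, 1 ≤ K₁ ∧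
        (∀ t : ℝ, t < 0 → ∀ (x ξ : EuclideanSpace ℝ (Fin 3)),
          (-t) * ⟪fderiv ℝ (v t) x ξ, ξ⟫ ≤ K₁ * ‖ξ‖ ^ 2) ∧
        ∀ (t₀ t₁ δ : ℝ), t₀ < t₁ → t₁ < 0 → 0 < δ →
        ∀ (χ : ℝ → ℝ), Continuous χ → (∀ t, 0 ≤ χ t) →
          (∀ t ∈ Set.Icc t₀ t₁,
            (∃ (x ξ : EuclideanSpace ℝ (Fin 3)),
              (1 - δ) * ‖ξ‖ ^ 2 < (-t) * ⟪fderiv ℝ (v t) x ξ, ξ⟫) → 1 ≤ χ t) →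
          δ / (K₁ - 1 + δ) * Real.log (t₀ / t₁) - K / (K₁ - 1 + δ) ≤
            ∫ t in t₀..t₁, χ t / (-t) := by
  intro C u p G v hsw hwg hI hdec hsing hv hae
  obtain ⟨K, hK⟩ := stub_clockKeepsClock C u p G v hsw hwg hI hdec hsing hv hae
  obtain ⟨K₁, hK₁, hgauge⟩ := clockED_strain_gauge C
  refine ⟨K, K₁, hK₁, fun t ht x ξ => hgauge hv t ht x ξ, ?_⟩
  intro t₀ t₁ δ h01 h1 hδ χ hχ hχ0 hact
  exact clock_epochDensity h01 h1 hK₁ hδ (fun t ht x ξ => hgauge hv t (ht.2.trans_lt h1) x ξ)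
    (hK t₀ t₁ h01 h1) χ hχ hχ0 hact

end Summit.NavierStokesRegularity.NavierStokesRegularity.Theorems

end
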